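import Summits.Ventures.PercRepro.S3LPCellP9D9A
import Summits.Ventures.PercRepro.S3LPCellP9D9B
import Summits.Ventures.PercRepro.S3MaxFlatSplit

/-!
# PercRepro — THE LEVEL-6 CELL `(9, 9)` FOR THE `e`-FREE CORE: RANK `9` ON `18` POINTS, CONSTANT `18/7` — BY THE MAXIMAL-FLAT SPLIT
(p7 g22, S3 feeder; p8's statement shape)

p2's nullity-split coloop/closure LP does not close the cell `(9, 9)` at its natural constant: its adversary lives on the maximal
rank-`6` flats (`n − 4 = 14` points). The split: either every set of rank `≤ 6` has `≤ 13` points — then the LP closes with that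
extra hypothesis (`s6lp_9_18_of_flat13`, S3LPCellP9D9A) — or a rank-`6` set `F` with `14` points exists, and the rows of the
maximal flat (a `U`-set meets `E ∖ F` in at most one point; the glued sets `S ∪ T` are distinct `Y`-sets; `F`'s partition rows)
close it (`s6lp_9_18_of_maxflat`, S3LPCellP9D9B). `six_le_of_no_maxflat` (S3MaxFlatSplit) is the dichotomy.

* **`s6lp_9_18`**.
Axioms: standard.
-/

open scoped Matroid

namespace PercRepro

namespace S3LP

open Set Finset S2LP S3MF

variable {α : Type}

/-- **THE LEVEL-6 CELL `(9, 9)`**: rank `9` on `18` points, constant `18/7`, by the maximal-flat split. -/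
theorem s6lp_9_18 (M : Matroid α) [M.Finite] (hM : M.eRank = ((9 : ℕ) : ℕ∞))
    (hE : M.E.ncard = 18) (hcol : M.coloops = ∅) (hpairs : ∀ e ∈ M.E, ∀ f ∈ M.E, e ≠ f → M.eRk {e, f} = 2)
    (hlines : ∀ L ⊆ M.E, M.eRk L = 2 → L.ncard ≤ 3) (hplanes : ∀ P ⊆ M.E, M.eRk P ≤ 3 → P.ncard ≤ 6)
    (htens : ∀ X ⊆ M.E, M.eRk X ≤ 4 → X.ncard ≤ 10) (hnineteen : ∀ X ⊆ M.E, M.eRk X ≤ 5 → X.ncard ≤ 19) :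
    (18 / 7 : ℚ) * (Matroid.topCount M 9 6 : ℚ) ≤ (Matroid.midCount M 9 6 : ℚ) := by
  by_cases h : ∃ F ⊆ M.E, M.eRk F = ((6 : ℕ) : ℕ∞) ∧ F.ncard + 4 = M.E.ncard
  · obtain ⟨F, hF, hFr, hFn⟩ := h
    exact s6lp_9_18_of_maxflat M hM hE hcol hpairs hlines hplanes htens hnineteen F hF hFr hFn
  · have hsix : ∀ X ⊆ M.E, M.eRk X ≤ 6 → X.ncard ≤ 13 := fun X hX h6 => by
      have := six_le_of_no_maxflat hM hE hcol h X hX h6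
      omega
    exact s6lp_9_18_of_flat13 M hM hE hcol hpairs hlines hplanes htens hnineteen hsix

end S3LP

end PercRepro
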